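import Summits.HubbardSuperconductivity.HubbardSuperconductivity.Theorems.SoloBlindDimerPairField
import HarnessLib

/-!
# The Gutzwiller dimer condensate and the `U`-uniform crutch threshold (solo-blind programme, Theorem 33)

Theorems 23/24 (`SoloBlindCrutchAxis`, `SoloBlindVariationalCrutch`) put d-wave pair-field
long-range order on EVERY sector ground state of the crutched Hubbard Hamiltonian
`H_L(g) = hubbardTorus 2 L 1 U - (g/L²) Δᴴ Δ`, `Δ = pairField dWaveFormFactor L`, once
`g ≥ 16384 (8 + U)/(1 - δ)`: a threshold growing linearly in `U`, because the comparison there is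
made against the full energy WIDTH `16n + U L²` of the doped sector.  This file removes the
`U`-dependence: **`g ≥ 32/δ` suffices for every `U ≥ 0`** (`uniform_crutch_hasLongRangeOrder`).

The mechanism is a real-space, Gutzwiller-projected (RVB-type, [Anderson1987],
[ZhangGrosRiceShiba1988]) trial state for the variational principle of Theorem 24(c)
(`CrutchAxis.crutch_hasLongRangeOrder_of_trials`).  On an even torus call a site `k` a *slot* if
its second coordinate is even (`dimerSlots`, `#slots = L²/2`, `two_mul_card_dimerSlots`), and let
the *vertical dimer* at `k` occupy the orbitals `(k,↓)` and `(k + e₂,↑)` (`dimerConfig`).  The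
`n`-dimer condensate is the unsigned sum `Ψ_n = Σ_{S ⊆ slots, #S = n} e_{dimerConfig S}`.

* The two orbitals of a dimer are ADJACENT in the Jordan–Wigner order of the fermionic torus
  (`dn_lt_iff_up_le`), so no sign strings appear (`jwSign_up_eq_jwSign_dn`), and the d-wave pair
  field removes one dimer with the coherent amplitude `-√2`: the bond is seen once as `(x, x+e₂)`
  and once as `(x+e₂, x+e₂-e₂)`, each orientation contributing `-1/√2` after its Jordan–Wigner
  sign (`pairField_apply_dimerConfig`, `sign_dn_up`, `sign_up_dn`; the `±e₁` bonds and all other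
  terms vanish between dimer configurations, `entry_dn_up_eq_zero`, `entry_up_dn_eq_zero`).
* Hence `⟨Ψ_{n-1}, Δ Ψ_n⟩ = -√2 · C(M, n-1) · (M - n + 1)`, `M = L²/2`
  (`star_condensate_dotProduct_pairField_mulVec_condensate`), and Cauchy–Schwarz with Pascal's
  rule gives the ORDER FLOOR `⟨Ψ_n, ΔᴴΔ Ψ_n⟩ ≥ 2 n (M - n + 1) ‖Ψ_n‖²` (`condensate_order_ge`) —
  Yang's value `n(M - n + 1)` [Yang1962] for `M = L²/2` hard-core pair modes, i.e. `≈ δ(1-δ)L⁴/2`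
  in the doped sector: the pairing amplitude of the projected condensate is renormalised by the
  hole density, as in renormalised mean-field theory.
* No site of a dimer configuration is doubly occupied (`not_double`), so the Hubbard interaction
  annihilates `Ψ_n` (`interaction_mulVec_condensate`) and `re⟨Ψ_n, H_U Ψ_n⟩ ≤ 8n ‖Ψ_n‖²` for EVERY
  `U` (`re_expect_hubbardTorus_condensate_le`), while `min_K H_U ≥ -8n` for `U ≥ 0`
  (`neg_le_minEnergyOn`).
* With `n = ⌊(1-δ)L²/2⌋`, `M - n + 1 ≥ δL²/2` and `gδ ≥ 32` the crutched energy of `Ψ_n` lies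
  `(gδ/16) L² ‖Ψ_n‖²` below `min_K H_U` (`dimerCondensate_trial`, even `L ≥ 4`), and Theorem 24(c)
  turns this into `HasLongRangeOrder` in the summit's exact shape, with order density `δ/16`
  (`uniform_crutch_hasLongRangeOrder`).

Honest label: kinematics plus the variational principle.  The crutch `-(g/L²)ΔᴴΔ` is an explicit,
extensive BCS-type attraction; the theorem says nothing about obstruction W3 of the obstruction
report (whether the repulsive Hubbard interaction itself generates the attraction).  It sharpens the
map of the `(U, g)` plane of report §5.20: the region of proved order now contains the
`U`-independent half-line `g ≥ 32/δ`, complementing the `g`-independent no-order results at small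
`U` on the pure Hubbard axis `g = 0`.
-/

noncomputable section

namespace Summit.HubbardSuperconductivity.HubbardSuperconductivity.Theorems.DimerCondensate

open Matrix Finset Literature.Probability.LatticeModels Literature.MathematicalPhysics.QuantumLattice
  Literature.MathematicalPhysics.QuantumLattice.EigenvalueContinuation
open scoped ComplexOrder ComplexConjugate

variable {L : ℕ} [NeZero L]

/-- Torus sites are compared through the linear order: this pins `DecidableEq (FermionTorus 2 L)`
(hence `insert`/`image` on orbital configurations) to the instance carried by the orbital-generic
tree lemmas (`annihilation_apply`, `jwSign_insert_of_lt`, …), as in `DopedRVBState`. [folklore] -/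
local instance (priority := high) instDecidableEqFermionTorusDimer₃ : DecidableEq (FermionTorus 2 L) :=
  LinearOrder.toDecidableEq

/-- The vertical unit step `e₂ = (0, 1)` of `ℤ²` (literal term). -/
local notation "𝐞" => (Pi.single 1 1 : Site 2)

/-- The down orbital `(k, ↓)` of the vertical dimer at `k`. -/
local notation "D[" k "]" => (orb (FermionTorus.ofTorusSite k) 1)

/-- The up orbital `(k + e₂, ↑)` of the vertical dimer at `k`. -/
local notation "U[" k "]" => (orb (FermionTorus.ofTorusSite (k + Torus.proj L 𝐞)) 0)

/-- The basis vector of the dimer configuration `S`. -/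
local notation "Φ[" S "]" => (Pi.single (dimerConfig S) (1 : ℂ) : Fock (Orb (FermionTorus 2 L)))

/-- The `j`-dimer condensate: the unsigned sum of all dimer configurations on `j` slots. -/
local notation "Ψ[" j "]" => (∑ S ∈ Finset.powersetCard j (dimerSlots L), Φ[S])

/-! ### The channel count and the order floor -/

omit [NeZero L] in
/-- `⟨e_t, v⟩ = v t` (file-local copy). [folklore] -/
private theorem star_single_dotProduct' (t : Finset (Orb (FermionTorus 2 L)))
    (v : Fock (Orb (FermionTorus 2 L))) :
    star (Pi.single t (1 : ℂ) : Fock (Orb (FermionTorus 2 L))) ⬝ᵥ v = v t := by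
  rw [← Pi.single_star, star_one, single_dotProduct, one_mul]

omit [NeZero L] in
/-- `(M e_s) t = M t s` (file-local copy). [folklore] -/
private theorem mulVec_single_one_apply'
    (M : Matrix (Finset (Orb (FermionTorus 2 L))) (Finset (Orb (FermionTorus 2 L))) ℂ)
    (t s : Finset (Orb (FermionTorus 2 L))) :
    (M *ᵥ (Pi.single s (1 : ℂ) : Fock (Orb (FermionTorus 2 L)))) t = M t s := by
  rw [mulVec_single_one]; rfl

/-- **Channel count**: the overlap of a `j`-dimer configuration `T ⊆ slots` with `Δ_d Ψ_{j+1}` is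
`-√2 · (#slots - j)` — one channel per free slot, all with the same sign. [this work] -/
theorem star_basis_dotProduct_pairField_mulVec_condensate (hL3 : 3 ≤ L) (hL : Even L)
    {T : Finset (TorusSite 2 L)} {j : ℕ} (hT : T ∈ Finset.powersetCard j (dimerSlots L)) :
    star Φ[T] ⬝ᵥ (pairField dWaveFormFactor L *ᵥ Ψ[j + 1]) =
      -((Real.sqrt 2 : ℝ) : ℂ) * (((dimerSlots L).card - j : ℕ) : ℂ) := by
  obtain ⟨hTs, hTj⟩ := Finset.mem_powersetCard.1 hT
  rw [star_single_dotProduct', Matrix.mulVec_sum, Finset.sum_apply]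
  simp_rw [mulVec_single_one_apply']
  rw [Finset.sum_congr rfl fun S hS =>
    pairField_apply_dimerConfig hL3 hL (Finset.mem_powersetCard.1 hS).1 T, Finset.sum_comm]
  have inner : ∀ z : TorusSite 2 L,
      (∑ S ∈ Finset.powersetCard (j + 1) (dimerSlots L),
        if z ∉ T ∧ S = insert z T then -((Real.sqrt 2 : ℝ) : ℂ) else 0) =
      if z ∈ dimerSlots L \ T then -((Real.sqrt 2 : ℝ) : ℂ) else 0 := by
    intro z
    by_cases hz : z ∈ dimerSlots L \ T
    · rw [if_pos hz]
      obtain ⟨hzs, hzT⟩ := Finset.mem_sdiff.1 hz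
      have hmem : insert z T ∈ Finset.powersetCard (j + 1) (dimerSlots L) := by
        rw [Finset.mem_powersetCard]
        exact ⟨Finset.insert_subset hzs hTs, by rw [Finset.card_insert_of_notMem hzT, hTj]⟩
      rw [Finset.sum_eq_single_of_mem _ hmem]
      · rw [if_pos ⟨hzT, rfl⟩]
      · intro S _ hS
        rw [if_neg (fun h => hS h.2)]
    · rw [if_neg hz]
      refine Finset.sum_eq_zero fun S hS => ?_
      rw [if_neg]
      rintro ⟨hzT, rfl⟩
      exact hz (Finset.mem_sdiff.2
        ⟨(Finset.mem_powersetCard.1 hS).1 (mem_insert_self z T), hzT⟩)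
  rw [Finset.sum_congr rfl fun z _ => inner z, Finset.sum_ite_mem, Finset.univ_inter,
    Finset.sum_const, Finset.card_sdiff_of_subset hTs, hTj, nsmul_eq_mul, mul_comm]

/-- **Overlap of consecutive condensates through the pair field**:
`⟨Ψ_j, Δ_d Ψ_{j+1}⟩ = -√2 · C(#slots, j) · (#slots - j)`. [this work] -/
theorem star_condensate_dotProduct_pairField_mulVec_condensate (hL3 : 3 ≤ L) (hL : Even L)
    (j : ℕ) :
    star Ψ[j] ⬝ᵥ (pairField dWaveFormFactor L *ᵥ Ψ[j + 1]) =
      -((Real.sqrt 2 : ℝ) : ℂ) *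
        ((((dimerSlots L).card.choose j : ℕ) : ℂ) * (((dimerSlots L).card - j : ℕ) : ℂ)) := by
  rw [star_sum, sum_dotProduct, Finset.sum_congr rfl fun T hT =>
    star_basis_dotProduct_pairField_mulVec_condensate hL3 hL hT, Finset.sum_const,
    Finset.card_powersetCard, nsmul_eq_mul]
  ring

omit [NeZero L] in
/-- `⟨x, A y⟩ = ⟨Aᴴ x, y⟩` (file-local copy of a folklore identity). [folklore] -/
private theorem star_dotProduct_mulVec_eq' (A : Matrix (Finset (Orb (FermionTorus 2 L)))
    (Finset (Orb (FermionTorus 2 L))) ℂ) (x y : Fock (Orb (FermionTorus 2 L))) :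
    star x ⬝ᵥ (A *ᵥ y) = star (Aᴴ *ᵥ x) ⬝ᵥ y := by
  rw [star_mulVec, conjTranspose_conjTranspose, dotProduct_mulVec]

/-- **Theorem 33a (order floor of the dimer condensate).** On an even torus of side `L ≥ 3`,
`2 (j+1) (#slots - j) ‖Ψ_{j+1}‖² ≤ ⟨Ψ_{j+1}, Δ_dᴴ Δ_d Ψ_{j+1}⟩` (Cauchy–Schwarz against `Ψ_j`
and Pascal's rule). With `#slots = L²/2` and `j + 1 = n ≈ (1-δ)L²/2` this is `≳ δ(1-δ) L⁴ / 2`.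
[this work] -/
theorem condensate_order_ge (hL3 : 3 ≤ L) (hL : Even L) (j : ℕ) :
    2 * ((j + 1 : ℕ) : ℝ) * (((dimerSlots L).card - j : ℕ) : ℝ) * (star Ψ[j + 1] ⬝ᵥ Ψ[j + 1]).re ≤
      (star Ψ[j + 1] ⬝ᵥ
        ((pairField dWaveFormFactor L)ᴴ * pairField dWaveFormFactor L) *ᵥ Ψ[j + 1]).re := by
  set x := Ψ[j] with hx
  set Ψ' := Ψ[j + 1] with hΨ'
  set y := pairField dWaveFormFactor L *ᵥ Ψ' with hy
  set m := (dimerSlots L).card with hm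
  have hR : (star Ψ' ⬝ᵥ ((pairField dWaveFormFactor L)ᴴ * pairField dWaveFormFactor L) *ᵥ Ψ').re =
      (star y ⬝ᵥ y).re := by
    rw [hy, ← mulVec_mulVec, star_dotProduct_mulVec_eq', conjTranspose_conjTranspose]
  have hxx : (star x ⬝ᵥ x).re = ((m.choose j : ℕ) : ℝ) := by
    rw [hx, star_condensate_dotProduct_self, Finset.card_powersetCard, Complex.natCast_re]
  have hΨΨ : (star Ψ' ⬝ᵥ Ψ').re = ((m.choose (j + 1) : ℕ) : ℝ) := by
    rw [hΨ', star_condensate_dotProduct_self, Finset.card_powersetCard, Complex.natCast_re]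
  have hxy : ‖star x ⬝ᵥ y‖ = Real.sqrt 2 * (((m.choose j : ℕ) : ℝ) * ((m - j : ℕ) : ℝ)) := by
    rw [hx, hy, hΨ', star_condensate_dotProduct_pairField_mulVec_condensate hL3 hL, norm_mul,
      norm_neg, Complex.norm_real, Real.norm_eq_abs, abs_of_nonneg (Real.sqrt_nonneg 2),
      ← Nat.cast_mul, Complex.norm_natCast, Nat.cast_mul]
  have hcs := norm_sq_star_dotProduct_le x y
  rw [hxy, hxx] at hcs
  have hyy0 : 0 ≤ (star y ⬝ᵥ y).re := by
    rw [← hR, hΨ']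
    exact (pairField_conjTranspose_mul_self_posSemidef dWaveFormFactor L).re_dotProduct_nonneg _
  have hpascal : ((m.choose (j + 1) : ℕ) : ℝ) * ((j + 1 : ℕ) : ℝ) =
      ((m.choose j : ℕ) : ℝ) * ((m - j : ℕ) : ℝ) := by
    exact_mod_cast Nat.choose_succ_right_eq m j
  have hsq : Real.sqrt 2 ^ 2 = 2 := Real.sq_sqrt (by norm_num)
  rw [hR, hΨΨ]
  by_cases hp : m.choose j = 0
  · have hj : m < j := Nat.choose_eq_zero_iff.1 hp
    have hp' : m.choose (j + 1) = 0 := Nat.choose_eq_zero_of_lt (by omega)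
    rw [hp', Nat.cast_zero, mul_zero]
    exact hyy0
  · have hppos : 0 < ((m.choose j : ℕ) : ℝ) := by exact_mod_cast Nat.pos_of_ne_zero hp
    have h1 : ((m.choose j : ℕ) : ℝ) * (((m.choose j : ℕ) : ℝ) * (2 * ((m - j : ℕ) : ℝ) ^ 2)) ≤
        ((m.choose j : ℕ) : ℝ) * (star y ⬝ᵥ y).re := by
      calc ((m.choose j : ℕ) : ℝ) * (((m.choose j : ℕ) : ℝ) * (2 * ((m - j : ℕ) : ℝ) ^ 2))
          = (Real.sqrt 2 * (((m.choose j : ℕ) : ℝ) * ((m - j : ℕ) : ℝ))) ^ 2 := by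
            rw [mul_pow, hsq]; ring
        _ ≤ _ := hcs
    have h2 := le_of_mul_le_mul_left h1 hppos
    calc 2 * ((j + 1 : ℕ) : ℝ) * ((m - j : ℕ) : ℝ) * ((m.choose (j + 1) : ℕ) : ℝ)
        = (((m.choose (j + 1) : ℕ) : ℝ) * ((j + 1 : ℕ) : ℝ)) * ((m - j : ℕ) : ℝ) * 2 := by ring
      _ = ((m.choose j : ℕ) : ℝ) * (2 * ((m - j : ℕ) : ℝ) ^ 2) := by rw [hpascal]; ring
      _ ≤ (star y ⬝ᵥ y).re := h2

/-! ### Energy of the condensate and the floor of the sector -/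

/-- **The Hubbard interaction annihilates every dimer configuration over slots** (no site is doubly
occupied: the Gutzwiller constraint). [this work; elementary] -/
theorem interaction_mulVec_basis (hL : Even L) {S : Finset (TorusSite 2 L)}
    (hS : S ⊆ dimerSlots L) :
    (∑ x : FermionTorus 2 L, numberOp x 0 * numberOp x 1) *ᵥ Φ[S] = 0 := by
  rw [Matrix.sum_mulVec]
  refine Finset.sum_eq_zero fun x _ => ?_
  funext s
  rw [← mulVec_mulVec, numberOp_mulVec_apply, numberOp_mulVec_apply, Pi.zero_apply,
    Pi.single_apply]
  by_cases hs : s = dimerConfig S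
  · rw [if_pos hs]
    subst hs
    by_cases h0 : orb x 0 ∈ dimerConfig S
    · rw [if_neg (fun h1 => not_double hL hS x ⟨h0, h1⟩), zero_mul, mul_zero]
    · rw [if_neg h0, zero_mul]
  · rw [if_neg hs, mul_zero, mul_zero]

/-- The interaction annihilates the condensate. [this work] -/
theorem interaction_mulVec_condensate (hL : Even L) (j : ℕ) :
    (∑ x : FermionTorus 2 L, numberOp x 0 * numberOp x 1) *ᵥ Ψ[j] = 0 := by
  rw [Matrix.mulVec_sum]
  exact Finset.sum_eq_zero fun S hS => interaction_mulVec_basis hL (Finset.mem_powersetCard.1 hS).1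

/-- **Energy of the condensate, uniformly in `U`**: `re ⟨Ψ_j, H_U Ψ_j⟩ ≤ 8 j ‖Ψ_j‖²` for EVERY
`U` (kinetic energy `≤ 4` per particle, interaction energy zero). [this work] -/
theorem re_expect_hubbardTorus_condensate_le (hL3 : 3 ≤ L) (hL : Even L) (U : ℝ) (j : ℕ) :
    (star Ψ[j] ⬝ᵥ (hubbardTorus 2 L 1 U *ᵥ Ψ[j])).re ≤ 8 * (j : ℝ) * (star Ψ[j] ⬝ᵥ Ψ[j]).re := by
  rw [hubbardTorus_eq_zero_add_smul_interaction U, add_mulVec, Matrix.smul_mulVec,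
    interaction_mulVec_condensate hL j, smul_zero, add_zero]
  have h := CrutchAxis.re_expect_hubbardTorus_zero_le hL3
    ((mem_szSector_two_mul_zero_iff j _).1 (condensate_mem_szSector (L := L) j))
  calc (star Ψ[j] ⬝ᵥ (hubbardTorus 2 L 1 0 *ᵥ Ψ[j])).re
      ≤ 4 * ((j : ℝ) + j) * (star Ψ[j] ⬝ᵥ Ψ[j]).re := h
    _ = 8 * (j : ℝ) * (star Ψ[j] ⬝ᵥ Ψ[j]).re := by ring

/-- **Floor of the doped sector**: `-8n ≤ minEnergyOn (H_U) (2n, S_z = 0)` for `U ≥ 0`, `L ≥ 3`,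
whenever the sector is non-trivial. [folklore] -/
theorem neg_le_minEnergyOn (hL3 : 3 ≤ L) {U : ℝ} (hU : 0 ≤ U) {n : ℕ}
    (hK : szSector (Λ := FermionTorus 2 L) (2 * n) 0 ≠ ⊥) :
    -(8 * (n : ℝ)) ≤
      (hubbardTorus 2 L 1 U).minEnergyOn (szSector (Λ := FermionTorus 2 L) (2 * n) 0) := by
  obtain ⟨φ, hφK, hφ1, hφE⟩ := exists_unit_eigen_minEnergyOn (isHermitian_hubbardTorus L 1 U) _
    (fun v hv =>
      _root_.Literature.MathematicalPhysics.QuantumLattice.hubbardTorus_mulVec_mem_szSector 1 U hv)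
    hK
  rw [← _root_.Literature.MathematicalPhysics.QuantumLattice.re_rayleigh_of_eigen_minEnergyOn _ _
    hφ1 hφE]
  exact (CrutchAxis.re_expect_hubbardTorus_mem_Icc hL3 hU hφK hφ1).1

/-! ### Theorem 33: the `U`-uniform crutch threshold -/

omit [NeZero L] in
/-- The Rayleigh quotient of `H + c O` splits. [folklore] -/
theorem re_rayleigh_add_real_smul (H O : Matrix (Finset (Orb (FermionTorus 2 L)))
    (Finset (Orb (FermionTorus 2 L))) ℂ) (c : ℝ) (v : Fock (Orb (FermionTorus 2 L))) :
    (star v ⬝ᵥ (H + (c : ℂ) • O) *ᵥ v).re =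
      (star v ⬝ᵥ H *ᵥ v).re + c * (star v ⬝ᵥ O *ᵥ v).re := by
  rw [add_mulVec, Matrix.smul_mulVec, dotProduct_add, dotProduct_smul, Complex.add_re, smul_eq_mul,
    Complex.re_ofReal_mul]

/-- **The dimer condensate as a variational trial state** (even side `L ≥ 4`, `U ≥ 0`,
`δ ∈ (0, 1/2)`, `g ≥ 32/δ`): with `n = ⌊(1-δ)L²/2⌋`, the `n`-dimer condensate `Ψ_n` satisfies
`re ⟨Ψ_n, (H_U - (g/L²) Δ_dᴴΔ_d) Ψ_n⟩ ≤ (minEnergyOn (H_U) (2n, 0) - (gδ/16) L²) ‖Ψ_n‖²`.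
[this work] -/
theorem dimerCondensate_trial (hL4 : 4 ≤ L) (hL : Even L) {U : ℝ} (hU : 0 ≤ U) {δ : ℝ}
    (hδ : δ ∈ Set.Ioo (0 : ℝ) (1 / 2)) {g : ℝ} (hg : 32 / δ ≤ g) :
    ∃ Ψ : Fock (Orb (FermionTorus 2 L)),
      Ψ ∈ szSector (Λ := FermionTorus 2 L) (2 * ⌊(1 - δ) * (L : ℝ) ^ 2 / 2⌋₊) 0 ∧ Ψ ≠ 0 ∧
      (star Ψ ⬝ᵥ (hubbardTorus 2 L 1 U + ((-(g / (L : ℝ) ^ 2) : ℝ) : ℂ) •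
          ((pairField dWaveFormFactor L)ᴴ * pairField dWaveFormFactor L)) *ᵥ Ψ).re ≤
        ((hubbardTorus 2 L 1 U).minEnergyOn
            (szSector (Λ := FermionTorus 2 L) (2 * ⌊(1 - δ) * (L : ℝ) ^ 2 / 2⌋₊) 0)
          - g * δ / 16 * (L : ℝ) ^ 2) * (star Ψ ⬝ᵥ Ψ).re := by
  obtain ⟨hδ0, hδ1⟩ := hδ
  have hL3 : 3 ≤ L := le_trans (by norm_num) hL4
  have hLr : (4 : ℝ) ≤ (L : ℝ) := by exact_mod_cast hL4
  have hLsq : (16 : ℝ) ≤ (L : ℝ) ^ 2 := by nlinarith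
  have hgδ : 32 ≤ g * δ := (div_le_iff₀ hδ0).1 hg
  have hg0 : 0 < g := lt_of_lt_of_le (by positivity) hg
  have harg : 0 ≤ (1 - δ) * (L : ℝ) ^ 2 / 2 := by nlinarith
  -- `n = ⌊(1-δ)L²/2⌋ = j + 1`
  have hn1 : 1 ≤ ⌊(1 - δ) * (L : ℝ) ^ 2 / 2⌋₊ := by
    rw [Nat.one_le_floor_iff]
    nlinarith
  obtain ⟨j, hj⟩ : ∃ j, ⌊(1 - δ) * (L : ℝ) ^ 2 / 2⌋₊ = j + 1 :=
    ⟨_, (Nat.sub_add_cancel hn1).symm⟩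
  have hn_le : ((j + 1 : ℕ) : ℝ) ≤ (1 - δ) * (L : ℝ) ^ 2 / 2 := by
    rw [← hj]; exact Nat.floor_le harg
  have hn_ge : (1 - δ) * (L : ℝ) ^ 2 / 2 - 1 ≤ ((j + 1 : ℕ) : ℝ) := by
    rw [← hj]; linarith [Nat.lt_floor_add_one ((1 - δ) * (L : ℝ) ^ 2 / 2)]
  rw [hj]
  -- `m = #slots = L²/2`
  set m := (dimerSlots L).card with hm
  have h2m : 2 * (m : ℝ) = (L : ℝ) ^ 2 := by exact_mod_cast two_mul_card_dimerSlots hL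
  have hjm : ((j + 1 : ℕ) : ℝ) ≤ (m : ℝ) := by nlinarith
  have hjm' : j + 1 ≤ m := by exact_mod_cast hjm
  have hmj : ((m - j : ℕ) : ℝ) = (m : ℝ) - j := by
    rw [Nat.cast_sub (by omega)]
  have hne : (Ψ[j + 1] : Fock (Orb (FermionTorus 2 L))) ≠ 0 := condensate_ne_zero hjm'
  have hK : szSector (Λ := FermionTorus 2 L) (2 * (j + 1)) 0 ≠ ⊥ :=
    (Submodule.ne_bot_iff _).2 ⟨_, condensate_mem_szSector (j + 1), hne⟩
  refine ⟨Ψ[j + 1], condensate_mem_szSector (j + 1), hne, ?_⟩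
  rw [re_rayleigh_add_real_smul]
  set P := (star Ψ[j + 1] ⬝ᵥ Ψ[j + 1]).re with hP
  have hP0 : 0 ≤ P := (re_star_dotProduct_self_pos hne).le
  have hO := condensate_order_ge hL3 hL j
  have hH := re_expect_hubbardTorus_condensate_le hL3 hL U (j + 1)
  have hmin := neg_le_minEnergyOn hL3 hU hK
  rw [hmj] at hO
  -- abbreviations
  set n' : ℝ := ((j + 1 : ℕ) : ℝ) with hn'
  set E := (hubbardTorus 2 L 1 U).minEnergyOn (szSector (Λ := FermionTorus 2 L) (2 * (j + 1)) 0)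
    with hE
  set RO := (star Ψ[j + 1] ⬝ᵥ
    ((pairField dWaveFormFactor L)ᴴ * pairField dWaveFormFactor L) *ᵥ Ψ[j + 1]).re with hRO
  set RH := (star Ψ[j + 1] ⬝ᵥ hubbardTorus 2 L 1 U *ᵥ Ψ[j + 1]).re with hRH
  have hjr : (j : ℝ) = n' - 1 := by
    rw [hn']; push_cast; ring
  -- `m - j ≥ δ L² / 2`
  have hmj_ge : δ * (L : ℝ) ^ 2 / 2 ≤ (m : ℝ) - j := by rw [hjr]; linarith
  -- `n' ≥ L²/8`
  have hn'_ge : (L : ℝ) ^ 2 / 8 ≤ n' := by nlinarith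
  -- the key numerical inequality `16 n' + (gδ/16) L² ≤ (g/L²) · 2 n' (m - j)`
  have e1 : g / (L : ℝ) ^ 2 * (2 * n' * (δ * (L : ℝ) ^ 2 / 2)) = g * δ * n' := by
    field_simp
  have e2 : g / (L : ℝ) ^ 2 * (2 * n' * (δ * (L : ℝ) ^ 2 / 2)) ≤
      g / (L : ℝ) ^ 2 * (2 * n' * ((m : ℝ) - j)) :=
    mul_le_mul_of_nonneg_left (mul_le_mul_of_nonneg_left hmj_ge (by positivity)) (by positivity)
  have p1 : 0 ≤ (g * δ - 32) * n' := mul_nonneg (by linarith) (by positivity)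
  have p2 : 0 ≤ g * δ * (n' - (L : ℝ) ^ 2 / 8) := mul_nonneg (by positivity) (by linarith)
  have key : 16 * n' + g * δ / 16 * (L : ℝ) ^ 2 ≤ g / (L : ℝ) ^ 2 * (2 * n' * ((m : ℝ) - j)) := by
    nlinarith [e1, e2, p1, p2]
  -- assemble
  have stepa : -(g / (L : ℝ) ^ 2) * RO ≤ -(g / (L : ℝ) ^ 2) * (2 * n' * ((m : ℝ) - j) * P) :=
    mul_le_mul_of_nonpos_left hO (by rw [neg_nonpos]; positivity)
  have stepb : (8 * n' - g / (L : ℝ) ^ 2 * (2 * n' * ((m : ℝ) - j))) * P ≤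
      (E - g * δ / 16 * (L : ℝ) ^ 2) * P :=
    mul_le_mul_of_nonneg_right (by linarith) hP0
  nlinarith [hH, stepa, stepb]

/-- **Theorem 33 (the `U`-uniform crutch threshold).** For every `U ≥ 0`, `δ ∈ (0, 1/2)` and
every `g ≥ 32/δ`, EVERY normalised ground-state family of the crutched Hubbard Hamiltonians
`H_U - (g/L²) Δ_dᴴ Δ_d` in the doped sectors `(2⌊(1-δ)L²/2⌋, S_z = 0)` of the even tori has d-wave
pair-field long-range order (of size `≥ δ L⁴ / 16` in `Σ_{x,y} ⟨Δ_x^† Δ_y⟩`). The threshold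
`32/δ` does not depend on `U` (Theorem 23 needed `g ≥ 16384 (8+U)/(1-δ)`). [this work] -/
theorem uniform_crutch_hasLongRangeOrder {U : ℝ} (hU : 0 ≤ U) {δ : ℝ}
    (hδ : δ ∈ Set.Ioo (0 : ℝ) (1 / 2)) {g : ℝ} (hg : 32 / δ ≤ g)
    (ψ : ∀ L, Fock (Orb (FermionTorus 2 L)))
    (hψ : ∀ m : ℕ, Even (m + 1) → star (ψ (m + 1)) ⬝ᵥ ψ (m + 1) = 1 ∧
      IsGroundStateInSector
        (hubbardTorus 2 (m + 1) 1 U + ((-(g / ((m + 1 : ℕ) : ℝ) ^ 2) : ℝ) : ℂ) •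
          ((pairField dWaveFormFactor (m + 1))ᴴ * pairField dWaveFormFactor (m + 1)))
        (2 * ⌊(1 - δ) * ((m + 1 : ℕ) : ℝ) ^ 2 / 2⌋₊) 0 (ψ (m + 1))) :
    HasLongRangeOrder (fun k => halfOpenBox 2 (2 * k))
      (fun k => torusPullback (pairFieldCorr dWaveFormFactor ψ) (2 * k)) := by
  have hδ0 : 0 < δ := hδ.1
  have hg0 : 0 < g := lt_of_lt_of_le (by positivity) hg
  have hκ : 0 < g * δ / 16 := by positivity
  exact CrutchAxis.crutch_hasLongRangeOrder_of_trials U hg0 hκ (L₁ := 4)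
    (fun m hm h4 => dimerCondensate_trial (L := m + 1) h4 hm hU hδ hg) ψ hψ

end Summit.HubbardSuperconductivity.HubbardSuperconductivity.Theorems.DimerCondensate
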